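import Summits.AnomalousDissipation.AnomalousDissipation.Theorems.MarginalStabilityChainChainRealisationForwardPhase
import Summits.AnomalousDissipation.AnomalousDissipation.Theorems.MarginalStabilityChainChainRealisationReduction
import HarnessLib

/-!
# Line `SketchIdeator2` is dominated by the route target
# (crux stmt-AnomalousDissipation-14249, `MarginalStabilityChain.ChainRealisation`; line lead c6, 2026-08-16)

Two sorry-free glue theorems recording, by name, why the picked line cannot close the crux before the route target
`ChainThesis` (stmt-AnomalousDissipation-3005) is itself proved:

* `chainThesis_of_contrastFamily` — the line's ONE open stub, the contrast family (`ContrastFamily` of the skeleton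
  `Cruxes/ChainRealisation/Lines/SketchIdeator2.lean` §3, written out), already proves the route TARGET `ChainThesis`
  (budget step `stub_loudOfContrastZM` + the landed forward phase `forwardPhaseH2_holds` + eternalisation
  `chainThesis_of_forwardPhaseH2`), not merely the crux.  So the residual is a STRENGTHENING of stmt-3005 (the zeroth
  law for ONE specific `2½`-D-forced arena), and every proof of it is a proof of 3005.
* `chainRealisation_residual_iff` — given the single-layer law `StrainedLayerLaw` (stmt-3007, which no line of this
  crux attacks), the crux is LITERALLY the target (`Reduction.chainRealisation_iff_chainThesis_of`, valid because
  3008 and 3009 are theorems), so the only two ways to close stmt-14249 are `¬ StrainedLayerLaw` or `ChainThesis`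
  (`Reduction.chainRealisation_iff_not_or`); the line supplies neither except through its residual ⇒ `ChainThesis`.

No definitions, no named facts, no new mathematics: bookkeeping for the planner (the line is a line for 3005).
-/

set_option linter.dupNamespace false

noncomputable section

open MeasureTheory Set Filter Topology
open scoped InnerProductSpace
open Literature.Analysis.FunctionSpaces Literature.Analysis.FunctionSpaces.Torus
open Literature.Analysis.FluidPDE Literature.Analysis.FluidPDE.Torus

namespace Summit.AnomalousDissipation.AnomalousDissipation.Theorems.ChainRealisation.SeparatrixFluxPinning

open Summit.AnomalousDissipation.AnomalousDissipation.Theses.MarginalStabilityChain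

/-- **The residual of line `SketchIdeator2` proves the route target.**  The contrast family (a smooth planar
solenoidal mean-free `g`, a smooth mean-free axial pattern `h`, `μ > 0`, a `ν`-uniform axial-contrast floor `a₀ > 0`
at limsup-mean energy `≤ E` along forward classical mean-zero regular trajectories of the arena force
`twoHalf g (μ • h)` with `ν_j → 0`) yields `ChainThesis` (stmt-AnomalousDissipation-3005): the budget step turns the
contrast floor into the dissipation floor `μ a₀` (`stub_loudOfContrastZM`), and the landed forward phase plus
eternalisation (`chainThesis_of_forwardPhaseH2 forwardPhaseH2_holds`) make the loud forward family eternal. -/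
theorem chainThesis_of_contrastFamily :
    (∃ (g : UnitAddTorus (Fin 2) → EuclideanSpace ℝ (Fin 2)) (h : UnitAddTorus (Fin 2) → ℝ) (μ a₀ E : ℝ),
      IsSmooth g ∧ IsDivFree g ∧ HasZeroMean g ∧ IsSmooth h ∧ HasZeroMean h ∧ 0 < μ ∧ 0 < a₀ ∧
      ∃ (ν : ℕ → ℝ) (u : ℕ → ℝ → UnitAddTorus (Fin 3) → EuclideanSpace ℝ (Fin 3))
        (p : ℕ → ℝ → UnitAddTorus (Fin 3) → ℝ),
        (∀ j, 0 < ν j) ∧ Tendsto ν atTop (nhds 0) ∧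
        (∀ j, IsClassicalNSSolutionOn (Set.Ici 0) (ν j) (fun _ => twoHalf g (μ • h)) (u j) (p j)) ∧
        (∀ j, ∃ M : ℝ, ∀ t : ℝ, 0 ≤ t → gradNormSq (u j t) ≤ M) ∧
        (∀ j t, 0 ≤ t → HasZeroMean (u j t)) ∧
        (∀ j, meanEnergy (u j) ≤ E) ∧
        (∀ j, 0 ≤ longTimeAvgInf (fun t => ∫ x, ⟪g (planarProj x), planarProjE (u j t x)⟫_ℝ)) ∧
        (∀ j, a₀ ≤ longTimeAvgSup (fun t => ∫ x, h (planarProj x) * u j t x 2))) →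
    ChainThesis := by
  intro hCF
  obtain ⟨f, hf, hdiv, hmean, hC⟩ := stub_loudOfContrastZM (contrastPackage_of_contrastFamily hCF)
  exact chainThesis_of_forwardPhaseH2 forwardPhaseH2_holds hf hdiv hmean hC

/-- **Given the single-layer law, closing the crux through ANY residual `R` is the same as proving the target from
`R`.**  For every proposition `R` (e.g. the contrast family of line `SketchIdeator2`, or `FEED ∧ FLUXFLOOR` of line
`SketchIdeator1`): under `StrainedLayerLaw`, `(R → ChainRealisation) ↔ (R → ChainThesis)`
(`Reduction.chainRealisation_iff_chainThesis_of`; 3008 and 3009 are theorems).  Hence a line for stmt-14249 that does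
not refute stmt-3007 is a line for stmt-3005. -/
theorem chainRealisation_residual_iff :
    ∀ R : Prop, StrainedLayerLaw → ((R → ChainRealisation) ↔ (R → ChainThesis)) :=
  fun _ h2 => ⟨fun hR r => (Reduction.chainRealisation_iff_chainThesis_of h2).1 (hR r),
    fun hR r => Reduction.chainRealisation_of_chainThesis (hR r)⟩

end Summit.AnomalousDissipation.AnomalousDissipation.Theorems.ChainRealisation.SeparatrixFluxPinning

end
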